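import Mathlib

/-!
# Connectivity correlation inequalities for `φ_{w,q}`, every `q > 0` — the ROOT-FORM CALCULUS of the `q`-free `maj₃` inequality
# (file 61a: abstract two-special environments, the nested root functional `M̃`, and its exact behaviour under series / parallel
# attachment of a free edge)

Support file (`--supports stmt-CriticalPhenomena-4575`), FK sub-lane `prim-bschramm-fk-2` (gen 28); builds on p205010 (kernel theorem,
internal audit signed; external expert review pending).  Standard axioms, no sorries, no named facts.  Memo
FROM-fk-2-g28-ROOT-FORM.md (§1–§4), FK-Q2.md §37.

Writing a 2-connected series–parallel host as `H = x ∥ 𝓔` (`𝓔 = H \ x`, a two-terminal network carrying the other two special edges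
`y, z`), the levelwise `q`-free inequality for the majority function (memo FROM-fk-2-g23-THETA §1) becomes a statement about `𝓔` alone:
for every configuration `γ` of the free edges of `𝓔` and every pattern `P ⊆ {y,z}` (the specials put in the first replica) one records
the total cluster level `Λ_P(γ)` and the two bits `K¹_P(γ), K²_P(γ)` (poles of `𝓔` joined in replica 1 / replica 2).  This file
treats these data ABSTRACTLY (`EDat`, `Env`): it defines the nested root functional
`M̃(h₀ ≤ h₁; J) = Σ_γ h₁(γ)·slot₁(γ;J) + h₀(γ)·slot₀(γ;J)` (functional form; for `𝓔 = B_y ∥ B_z` this is the functional ♣ of memo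
FROM-fk-2-g27-ONEEAR-NF §4), the AND-type functionals in the cells of the root, the data of `f·𝓔` and `g∥𝓔` for a fresh free edge, and
proves the EXACT attachment rules of memo §2: a series edge is free ((S), `Mt_ser`), a parallel edge costs two contracted-AND terms, a
pointwise-nonnegative term and ONE signed term which vanishes under a series edge ((P), `Mt_par_ge`, `EDat.trE_ser`), and the two
nonnegativity transfers they imply (`Mt_ser_nonneg`: `M̃_{f·𝓔} ≥ 0` from `M̃_𝓔 ≥ 0` and AND_del; `Mt_par_ser_nonneg`: `M̃_{g∥(f·𝓔)} ≥ 0`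
from `M̃_𝓔 ≥ 0`, AND_del and the nested free AND) — the series half of the induction step of the word theorem ★(Θ) (memo §4(iii));
the parallel-over-parallel step, the AND closures and the base (`B_y ∥ B_z`: THEOREM G27 + kernel AND⁺ facts) are separate files.
Pure finite combinatorics: no graphs, no measures.
[folklore]
-/

noncomputable section

namespace Summit.CriticalPhenomena.PercolationContinuityZ3.Theorems

namespace FK

namespace RootForm

open Finset

/-- Real indicator of a decidable proposition. [folklore] -/
def ind (p : Prop) [Decidable p] : ℝ := if p then 1 else 0

/-- `ind` is invariant under logical equivalence. [folklore] -/
theorem ind_congr {p q : Prop} [Decidable p] [Decidable q] (h : p ↔ q) : ind p = ind q := by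
  unfold ind; by_cases hp : p <;> by_cases hq : q <;> simp_all

/-- `0 ≤ ind p`. [folklore] -/
theorem ind_nonneg (p : Prop) [Decidable p] : 0 ≤ ind p := by
  unfold ind; split_ifs <;> norm_num

/-- The indicator of `False` is `0` (any instance). [folklore] -/
@[simp] theorem ind_False {h : Decidable False} : @ind False h = 0 := by simp [ind]
/-- The indicator of `True` is `1` (any instance). [folklore] -/
@[simp] theorem ind_True {h : Decidable True} : @ind True h = 1 := by simp [ind]

/-- `l + 1 = J ↔ l = J − 1` (for `simp`). [folklore] -/
theorem add_one_eq_iff_eq_sub_one (l J : ℤ) : l + 1 = J ↔ l = J - 1 := by omega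

/-- The integer value of a Boolean. [folklore] -/
def bit (b : Bool) : ℤ := if b then 1 else 0

/-- `bit true = 1`. [folklore] -/
@[simp] theorem bit_true : bit true = 1 := rfl
/-- `bit false = 0`. [folklore] -/
@[simp] theorem bit_false : bit false = 0 := rfl

/-- Data of a two-special environment at one configuration and one pattern: total level `Λ` and the pole-connection bits of the two
replicas. [folklore] -/
structure PDat where
  /-- total cluster level `Λ = k(replica 1) + k(replica 2)` -/
  lam : ℤ
  /-- poles joined in replica 1 -/
  k1 : Bool
  /-- poles joined in replica 2 -/
  k2 : Bool

/-- The four pattern data of a configuration: `d0` both specials in replica 2, `dy` (`dz`) only `y` (`z`) in replica 1, `dyz` both in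
replica 1. [folklore] -/
structure EDat where
  /-- pattern `∅` -/
  d0 : PDat
  /-- pattern `{y}` -/
  dy : PDat
  /-- pattern `{z}` -/
  dz : PDat
  /-- pattern `{y,z}` -/
  dyz : PDat

/-- An abstract two-special environment over a configuration type `C`. [folklore] -/
def Env (C : Type*) := C → EDat

namespace PDat

/-- Data after attaching a fresh edge IN SERIES, the edge in replica 1 iff `b`. [folklore] -/
def ser (b : Bool) (d : PDat) : PDat := ⟨d.lam, b && d.k1, !b && d.k2⟩

/-- Data after attaching a fresh edge IN PARALLEL, the edge in replica 1 iff `b` (it closes a cycle in its replica iff the poles were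
joined there). [folklore] -/
def par (b : Bool) (d : PDat) : PDat := ⟨d.lam + bit (b && d.k1) + bit (!b && d.k2), b || d.k1, !b || d.k2⟩

/-- `[Λ + K¹ ≤ J]` (root in replica 1). [folklore] -/
def a1 (d : PDat) (J : ℤ) : ℝ := ind (d.lam + bit d.k1 ≤ J)
/-- `[Λ + K² ≤ J]` (root in replica 2). [folklore] -/
def a2 (d : PDat) (J : ℤ) : ℝ := ind (d.lam + bit d.k2 ≤ J)
/-- `[Λ ≤ J]` (root deleted). [folklore] -/
def adel (d : PDat) (J : ℤ) : ℝ := ind (d.lam ≤ J)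
/-- `[Λ + K¹ + K² ≤ J]` (root contracted). [folklore] -/
def acon (d : PDat) (J : ℤ) : ℝ := ind (d.lam + bit d.k1 + bit d.k2 ≤ J)
/-- root-exchange term `[Λ = J]·K¹`. [folklore] -/
def r1 (d : PDat) (J : ℤ) : ℝ := ind (d.lam = J ∧ d.k1 = true)
/-- root-exchange term `[Λ = J]·K²`. [folklore] -/
def r2 (d : PDat) (J : ℤ) : ℝ := ind (d.lam = J ∧ d.k2 = true)
/-- `[Λ = J]·[K¹ = K² = 0]`. [folklore] -/
def p00 (d : PDat) (J : ℤ) : ℝ := ind (d.lam = J ∧ d.k1 = false ∧ d.k2 = false)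
/-- `[Λ = J]·[K¹ = 0, K² = 1]`. [folklore] -/
def p01 (d : PDat) (J : ℤ) : ℝ := ind (d.lam = J ∧ d.k1 = false ∧ d.k2 = true)
/-- `[Λ = J]·[K¹ = 1, K² = 0]`. [folklore] -/
def p10 (d : PDat) (J : ℤ) : ℝ := ind (d.lam = J ∧ d.k1 = true ∧ d.k2 = false)
/-- the signed ("trouble") term `[Λ = J − 1]·[K¹ = K² = 1]` of the parallel rule. [folklore] -/
def tr (d : PDat) (J : ℤ) : ℝ := ind (d.lam = J - 1 ∧ d.k1 = true ∧ d.k2 = true)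

variable (d : PDat) (J : ℤ)

/-- Series edge in replica 1: `[Λ+K¹≤J]` unchanged. [folklore] -/
theorem a1_ser_true : (d.ser true).a1 J = d.a1 J := by
  obtain ⟨l, k1, k2⟩ := d; cases k1 <;> cases k2 <;> simp [ser, a1]
/-- Series edge in replica 2: `[Λ+K¹≤J]` becomes `[Λ≤J]`. [folklore] -/
theorem a1_ser_false : (d.ser false).a1 J = d.adel J := by
  obtain ⟨l, k1, k2⟩ := d; cases k1 <;> cases k2 <;> simp [ser, a1, adel]
/-- Series edge in replica 1: `[Λ+K²≤J]` becomes `[Λ≤J]`. [folklore] -/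
theorem a2_ser_true : (d.ser true).a2 J = d.adel J := by
  obtain ⟨l, k1, k2⟩ := d; cases k1 <;> cases k2 <;> simp [ser, a2, adel]
/-- Series edge in replica 2: `[Λ+K²≤J]` unchanged. [folklore] -/
theorem a2_ser_false : (d.ser false).a2 J = d.a2 J := by
  obtain ⟨l, k1, k2⟩ := d; cases k1 <;> cases k2 <;> simp [ser, a2]
/-- Series edge in replica 1: `[Λ=J]K¹` unchanged. [folklore] -/
theorem r1_ser_true : (d.ser true).r1 J = d.r1 J := by
  obtain ⟨l, k1, k2⟩ := d; cases k1 <;> cases k2 <;> simp [ser, r1]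
/-- Series edge in replica 2 kills `K¹`. [folklore] -/
theorem r1_ser_false : (d.ser false).r1 J = 0 := by
  obtain ⟨l, k1, k2⟩ := d; cases k1 <;> cases k2 <;> simp [ser, r1, ind]
/-- Series edge in replica 1 kills `K²`. [folklore] -/
theorem r2_ser_true : (d.ser true).r2 J = 0 := by
  obtain ⟨l, k1, k2⟩ := d; cases k1 <;> cases k2 <;> simp [ser, r2, ind]
/-- Series edge in replica 2: `[Λ=J]K²` unchanged. [folklore] -/
theorem r2_ser_false : (d.ser false).r2 J = d.r2 J := by
  obtain ⟨l, k1, k2⟩ := d; cases k1 <;> cases k2 <;> simp [ser, r2]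
/-- A series edge does not change the level. [folklore] -/
theorem adel_ser (b : Bool) : (d.ser b).adel J = d.adel J := by
  obtain ⟨l, k1, k2⟩ := d; cases b <;> simp [ser, adel]
/-- Contracted bracket after a series edge in replica 1. [folklore] -/
theorem acon_ser_true : (d.ser true).acon J = d.a1 J := by
  obtain ⟨l, k1, k2⟩ := d; cases k1 <;> cases k2 <;> simp [ser, acon, a1]
/-- Contracted bracket after a series edge in replica 2. [folklore] -/
theorem acon_ser_false : (d.ser false).acon J = d.a2 J := by
  obtain ⟨l, k1, k2⟩ := d; cases k1 <;> cases k2 <;> simp [ser, acon, a2]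
/-- No configuration of `f·𝓔` joins the poles in both replicas: the signed term vanishes. [folklore] -/
theorem tr_ser (b : Bool) : (d.ser b).tr J = 0 := by
  obtain ⟨l, k1, k2⟩ := d; cases b <;> cases k1 <;> cases k2 <;> simp [ser, tr, ind]


/-- Parallel edge in replica 1 shifts `[Λ+K¹≤J]` by one level. [folklore] -/
theorem a1_par_true : (d.par true).a1 J = d.a1 (J - 1) := by
  obtain ⟨l, k1, k2⟩ := d; cases k1 <;> cases k2 <;> simp [par, a1]
/-- Parallel edge in replica 2 turns `[Λ+K¹≤J]` into the contracted bracket. [folklore] -/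
theorem a1_par_false : (d.par false).a1 J = d.acon J := by
  obtain ⟨l, k1, k2⟩ := d; cases k1 <;> cases k2 <;> simp [par, a1, acon]
/-- Parallel edge in replica 1 turns `[Λ+K²≤J]` into the contracted bracket. [folklore] -/
theorem a2_par_true : (d.par true).a2 J = d.acon J := by
  obtain ⟨l, k1, k2⟩ := d; cases k1 <;> cases k2 <;> simp [par, a2, acon]
/-- Parallel edge in replica 2 shifts `[Λ+K²≤J]` by one level. [folklore] -/
theorem a2_par_false : (d.par false).a2 J = d.a2 (J - 1) := by
  obtain ⟨l, k1, k2⟩ := d; cases k1 <;> cases k2 <;> simp [par, a2]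
/-- Root exchange after a parallel edge in replica 1: shifted term plus the pointwise pieces `p00 + p01`. [folklore] -/
theorem r1_par_true : (d.par true).r1 J = d.r1 (J - 1) + d.p00 J + d.p01 J := by
  obtain ⟨l, k1, k2⟩ := d; cases k1 <;> cases k2 <;> simp [par, r1, p00, p01, ind] <;> split_ifs <;> norm_num <;> omega
/-- Root exchange after a parallel edge in replica 2: `p10` plus the signed term. [folklore] -/
theorem r1_par_false : (d.par false).r1 J = d.p10 J + d.tr J := by
  obtain ⟨l, k1, k2⟩ := d; cases k1 <;> cases k2 <;> simp [par, r1, p10, tr, add_one_eq_iff_eq_sub_one]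
/-- Mirror of `r1_par_false`. [folklore] -/
theorem r2_par_true : (d.par true).r2 J = d.p01 J + d.tr J := by
  obtain ⟨l, k1, k2⟩ := d; cases k1 <;> cases k2 <;> simp [par, r2, p01, tr, add_one_eq_iff_eq_sub_one]
/-- Mirror of `r1_par_true`. [folklore] -/
theorem r2_par_false : (d.par false).r2 J = d.r2 (J - 1) + d.p00 J + d.p10 J := by
  obtain ⟨l, k1, k2⟩ := d; cases k1 <;> cases k2 <;> simp [par, r2, p00, p10, ind] <;> split_ifs <;> norm_num <;> omega



/-- `0 ≤ p00`. [folklore] -/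
theorem p00_nonneg : 0 ≤ d.p00 J := ind_nonneg _
/-- `0 ≤ p01`. [folklore] -/
theorem p01_nonneg : 0 ≤ d.p01 J := ind_nonneg _
/-- `0 ≤ p10`. [folklore] -/
theorem p10_nonneg : 0 ≤ d.p10 J := ind_nonneg _
/-- `0 ≤ tr`. [folklore] -/
theorem tr_nonneg : 0 ≤ d.tr J := ind_nonneg _

end PDat

namespace EDat

/-- Pattern data after a series attachment (edge in replica 1 iff `b`). [folklore] -/
def ser (b : Bool) (e : EDat) : EDat := ⟨e.d0.ser b, e.dy.ser b, e.dz.ser b, e.dyz.ser b⟩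
/-- Pattern data after a parallel attachment (edge in replica 1 iff `b`). [folklore] -/
def par (b : Bool) (e : EDat) : EDat := ⟨e.d0.par b, e.dy.par b, e.dz.par b, e.dyz.par b⟩

/-- Slot-1 integrand of the nested root functional: `[Λ_∅+K¹_∅ ≤ J] − [Λ_yz+K¹_yz ≤ J] + Σ_r [Λ_r = J]K¹_r`. [folklore] -/
def slot1 (e : EDat) (J : ℤ) : ℝ := e.d0.a1 J - e.dyz.a1 J + e.dy.r1 J + e.dz.r1 J
/-- Slot-0 integrand: `[Λ_∅+K²_∅ ≤ J] − [Λ_yz+K²_yz ≤ J] − Σ_r [Λ_r = J]K²_r`. [folklore] -/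
def slot0 (e : EDat) (J : ℤ) : ℝ := e.d0.a2 J - e.dyz.a2 J - e.dy.r2 J - e.dz.r2 J
/-- AND-integrand, root deleted. [folklore] -/
def andDel (e : EDat) (J : ℤ) : ℝ := e.d0.adel J - e.dyz.adel J
/-- AND-integrand, root contracted. [folklore] -/
def andCon (e : EDat) (J : ℤ) : ℝ := e.d0.acon J - e.dyz.acon J
/-- AND-integrand, root in replica 1. [folklore] -/
def andE1 (e : EDat) (J : ℤ) : ℝ := e.d0.a1 J - e.dyz.a1 J
/-- AND-integrand, root in replica 2. [folklore] -/
def andE2 (e : EDat) (J : ℤ) : ℝ := e.d0.a2 J - e.dyz.a2 J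
/-- the signed term of the parallel rule. [folklore] -/
def trE (e : EDat) (J : ℤ) : ℝ := e.dy.tr J + e.dz.tr J
/-- pointwise-nonnegative pieces of the parallel rule. [folklore] -/
def P00 (e : EDat) (J : ℤ) : ℝ := e.dy.p00 J + e.dz.p00 J
/-- see `P00`. [folklore] -/
def P01 (e : EDat) (J : ℤ) : ℝ := e.dy.p01 J + e.dz.p01 J
/-- see `P00`. [folklore] -/
def P10 (e : EDat) (J : ℤ) : ℝ := e.dy.p10 J + e.dz.p10 J

variable (e : EDat) (J : ℤ)

/-- (S), upper section: a series edge in replica 1 leaves slot 1 unchanged. [folklore] -/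
theorem slot1_ser_true : (e.ser true).slot1 J = e.slot1 J := by
  simp [ser, slot1, PDat.a1_ser_true, PDat.r1_ser_true]
/-- (S): a series edge in replica 2 turns slot 1 into the deleted AND. [folklore] -/
theorem slot1_ser_false : (e.ser false).slot1 J = e.andDel J := by
  simp [ser, slot1, andDel, PDat.a1_ser_false, PDat.r1_ser_false]
/-- (S): a series edge in replica 1 turns slot 0 into the deleted AND. [folklore] -/
theorem slot0_ser_true : (e.ser true).slot0 J = e.andDel J := by
  simp [ser, slot0, andDel, PDat.a2_ser_true, PDat.r2_ser_true]
/-- (S), lower section: a series edge in replica 2 leaves slot 0 unchanged. [folklore] -/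
theorem slot0_ser_false : (e.ser false).slot0 J = e.slot0 J := by
  simp [ser, slot0, PDat.a2_ser_false, PDat.r2_ser_false]
/-- The deleted AND is unchanged by a series edge. [folklore] -/
theorem andDel_ser (b : Bool) : (e.ser b).andDel J = e.andDel J := by simp [ser, andDel, PDat.adel_ser]
/-- Contracted AND after a series edge in replica 1 = AND with the root in replica 1. [folklore] -/
theorem andCon_ser_true : (e.ser true).andCon J = e.andE1 J := by simp [ser, andCon, andE1, PDat.acon_ser_true]
/-- Contracted AND after a series edge in replica 2 = AND with the root in replica 2. [folklore] -/
theorem andCon_ser_false : (e.ser false).andCon J = e.andE2 J := by simp [ser, andCon, andE2, PDat.acon_ser_false]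
/-- (SQ): under a series edge the signed term of the parallel rule vanishes. [folklore] -/
theorem trE_ser (b : Bool) : (e.ser b).trE J = 0 := by simp [ser, trE, PDat.tr_ser]


/-- (P), sub-slot (1,1). [folklore] -/
theorem slot1_par_true : (e.par true).slot1 J = e.slot1 (J - 1) + e.P00 J + e.P01 J := by
  simp [par, slot1, P00, P01, PDat.a1_par_true, PDat.r1_par_true]; ring
/-- (P), sub-slot (1,0): contracted AND + pointwise term + the signed term. [folklore] -/
theorem slot1_par_false : (e.par false).slot1 J = e.andCon J + e.P10 J + e.trE J := by
  simp [par, slot1, andCon, P10, trE, PDat.a1_par_false, PDat.r1_par_false]; ring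
/-- (P), sub-slot (0,1). [folklore] -/
theorem slot0_par_true : (e.par true).slot0 J = e.andCon J - e.P01 J - e.trE J := by
  simp [par, slot0, andCon, P01, trE, PDat.a2_par_true, PDat.r2_par_true]; ring
/-- (P), sub-slot (0,0). [folklore] -/
theorem slot0_par_false : (e.par false).slot0 J = e.slot0 (J - 1) - e.P00 J - e.P10 J := by
  simp [par, slot0, P00, P10, PDat.a2_par_false, PDat.r2_par_false]; ring
/-- `0 ≤ P00`. [folklore] -/
theorem P00_nonneg : 0 ≤ e.P00 J := add_nonneg (PDat.p00_nonneg _ _) (PDat.p00_nonneg _ _)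
/-- `0 ≤ P01`. [folklore] -/
theorem P01_nonneg : 0 ≤ e.P01 J := add_nonneg (PDat.p01_nonneg _ _) (PDat.p01_nonneg _ _)
/-- `0 ≤ P10`. [folklore] -/
theorem P10_nonneg : 0 ≤ e.P10 J := add_nonneg (PDat.p10_nonneg _ _) (PDat.p10_nonneg _ _)
/-- `0 ≤ trE`. [folklore] -/
theorem trE_nonneg : 0 ≤ e.trE J := add_nonneg (PDat.tr_nonneg _ _) (PDat.tr_nonneg _ _)


end EDat

/-! ## Environments, the nested root functional and the hypothesis class -/

variable {C : Type*} [Fintype C] [Preorder C]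

/-- The environment `f · 𝓔` (fresh series edge; configurations `Bool × C`, the Boolean = the new edge in replica 1). [folklore] -/
def serE (E : Env C) : Env (Bool × C) := fun p => (E p.2).ser p.1
/-- The environment `g ∥ 𝓔` (fresh parallel edge). [folklore] -/
def parE (E : Env C) : Env (Bool × C) := fun p => (E p.2).par p.1

/-- The nested root functional `M̃_𝓔(h₀ ≤ h₁; J)` in functional form (slot 1 weighted by `h₁`, slot 0 by `h₀`). [folklore] -/
def Mt (E : Env C) (h0 h1 : C → ℝ) (J : ℤ) : ℝ := ∑ γ, (h1 γ * (E γ).slot1 J + h0 γ * (E γ).slot0 J)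

omit [Preorder C] in
/-- Splitting a sum over `Bool × C` into the two sections. [folklore] -/
theorem sum_bool_prod (F : Bool × C → ℝ) : ∑ p, F p = ∑ γ, F (true, γ) + ∑ γ, F (false, γ) := by
  rw [Fintype.sum_prod_type, Fintype.sum_bool]

omit [Fintype C] in
/-- Sections of a monotone weight on `Bool × C` are monotone. [folklore] -/
theorem mono_sec {H : Bool × C → ℝ} (hH : Monotone H) (b : Bool) : Monotone fun γ => H (b, γ) :=
  fun _ _ hxy => hH (Prod.mk_le_mk.2 ⟨le_rfl, hxy⟩)

omit [Fintype C] in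
/-- Lower section ≤ upper section of a monotone weight on `Bool × C`. [folklore] -/
theorem sec_le {H : Bool × C → ℝ} (hH : Monotone H) (γ : C) : H (false, γ) ≤ H (true, γ) :=
  hH (Prod.mk_le_mk.2 ⟨Bool.false_le _, le_rfl⟩)

omit [Preorder C] in
/-- **(S)** The series rule: `M̃_{f·𝓔}(H₀ ≤ H₁; J) = M̃_𝓔(H₀(f,·) ≤ H₁(t,·); J) + AND_del(H₁(f,·)) + AND_del(H₀(t,·))`. [folklore] -/
theorem Mt_ser (E : Env C) (H0 H1 : Bool × C → ℝ) (J : ℤ) :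
    Mt (serE E) H0 H1 J = Mt E (fun γ => H0 (false, γ)) (fun γ => H1 (true, γ)) J
      + ∑ γ, H1 (false, γ) * (E γ).andDel J + ∑ γ, H0 (true, γ) * (E γ).andDel J := by
  unfold Mt; rw [sum_bool_prod]
  simp only [serE, EDat.slot1_ser_true, EDat.slot1_ser_false, EDat.slot0_ser_true, EDat.slot0_ser_false]
  rw [← Finset.sum_add_distrib, ← Finset.sum_add_distrib, ← Finset.sum_add_distrib]
  exact Finset.sum_congr rfl fun γ _ => by ring

/-- **(P)** The parallel rule as an inequality: for monotone weights `0 ≤ H₀ ≤ H₁` on the configurations of `g ∥ 𝓔`,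
`M̃_{g∥𝓔}(H₀ ≤ H₁; J) ≥ M̃_𝓔(H₀(f,·) ≤ H₁(t,·); J−1) + AND_con(H₁(f,·); J) + AND_con(H₀(t,·); J) + Σ_γ (H₁(f,γ) − H₀(t,γ))·tr(γ;J)` — the
dropped terms are pointwise nonnegative. [folklore] -/
theorem Mt_par_ge (E : Env C) {H0 H1 : Bool × C → ℝ} (m0 : Monotone H0) (m1 : Monotone H1) (n0 : ∀ p, 0 ≤ H0 p)
    (le : ∀ p, H0 p ≤ H1 p) (J : ℤ) :
    Mt E (fun γ => H0 (false, γ)) (fun γ => H1 (true, γ)) (J - 1)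
      + ∑ γ, H1 (false, γ) * (E γ).andCon J + ∑ γ, H0 (true, γ) * (E γ).andCon J
      + ∑ γ, (H1 (false, γ) - H0 (true, γ)) * (E γ).trE J ≤ Mt (parE E) H0 H1 J := by
  unfold Mt; rw [sum_bool_prod]
  simp only [parE, EDat.slot1_par_true, EDat.slot1_par_false, EDat.slot0_par_true, EDat.slot0_par_false]
  rw [← Finset.sum_add_distrib, ← Finset.sum_add_distrib, ← Finset.sum_add_distrib, ← Finset.sum_add_distrib]
  apply Finset.sum_le_sum; intro γ _
  have h1 := sec_le m1 γ; have h0 := sec_le m0 γ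
  have ht := le (true, γ); have hf := le (false, γ); have hn := n0 (false, γ)
  nlinarith [(E γ).P00_nonneg J, (E γ).P01_nonneg J, (E γ).P10_nonneg J]

/-- **(S) transfers nonnegativity**: if `M̃_𝓔 ≥ 0` against every monotone weight pair `0 ≤ h₀ ≤ h₁` and the deleted AND of `𝓔` is
nonnegative against monotone nonnegative weights, then `M̃_{f·𝓔} ≥ 0` against every monotone weight pair. [folklore] -/
theorem Mt_ser_nonneg {E : Env C}
    (hM : ∀ h0 h1 : C → ℝ, Monotone h0 → Monotone h1 → (∀ γ, 0 ≤ h0 γ) → (∀ γ, h0 γ ≤ h1 γ) → ∀ J : ℤ, 0 ≤ Mt E h0 h1 J)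
    (hd : ∀ h : C → ℝ, Monotone h → (∀ γ, 0 ≤ h γ) → ∀ J : ℤ, 0 ≤ ∑ γ, h γ * (E γ).andDel J)
    {H0 H1 : Bool × C → ℝ} (m0 : Monotone H0) (m1 : Monotone H1) (n0 : ∀ p, 0 ≤ H0 p) (le : ∀ p, H0 p ≤ H1 p) (J : ℤ) :
    0 ≤ Mt (serE E) H0 H1 J := by
  rw [Mt_ser]
  refine add_nonneg (add_nonneg (hM _ _ (mono_sec m0 false) (mono_sec m1 true) (fun γ => n0 _)
    (fun γ => (sec_le m0 γ).trans (le _)) J) (hd _ (mono_sec m1 false) (fun γ => (n0 _).trans (le _)) J))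
    (hd _ (mono_sec m0 true) (fun γ => n0 _) J)

/-- **(SQ) transfers nonnegativity**: `M̃_{g∥(f·𝓔)} ≥ 0` (the parallel transform after a series edge) follows from `M̃_𝓔 ≥ 0`, the
deleted AND and the free nested AND of `𝓔` — the signed term of the parallel rule vanishes under the series edge. [folklore] -/
theorem Mt_par_ser_nonneg {E : Env C}
    (hM : ∀ h0 h1 : C → ℝ, Monotone h0 → Monotone h1 → (∀ γ, 0 ≤ h0 γ) → (∀ γ, h0 γ ≤ h1 γ) → ∀ J : ℤ, 0 ≤ Mt E h0 h1 J)
    (hd : ∀ h : C → ℝ, Monotone h → (∀ γ, 0 ≤ h γ) → ∀ J : ℤ, 0 ≤ ∑ γ, h γ * (E γ).andDel J)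
    (hf : ∀ h0 h1 : C → ℝ, Monotone h0 → Monotone h1 → (∀ γ, 0 ≤ h0 γ) → (∀ γ, h0 γ ≤ h1 γ) → ∀ J : ℤ,
      0 ≤ ∑ γ, (h1 γ * (E γ).andE1 J + h0 γ * (E γ).andE2 J))
    {H0 H1 : Bool × (Bool × C) → ℝ} (m0 : Monotone H0) (m1 : Monotone H1) (n0 : ∀ p, 0 ≤ H0 p) (le : ∀ p, H0 p ≤ H1 p)
    (J : ℤ) : 0 ≤ Mt (parE (serE E)) H0 H1 J := by
  refine le_trans ?_ (Mt_par_ge (serE E) m0 m1 n0 le J)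
  have hvan : ∑ p : Bool × C, (H1 (false, p) - H0 (true, p)) * (serE E p).trE J = 0 :=
    Finset.sum_eq_zero fun p _ => by simp [serE, EDat.trE_ser]
  rw [hvan, add_zero]
  refine add_nonneg (add_nonneg (Mt_ser_nonneg hM hd (mono_sec m0 false) (mono_sec m1 true) (fun p => n0 _)
    (fun p => (sec_le m0 p).trans (le _)) _) ?_) ?_
  · rw [sum_bool_prod]; simp only [serE, EDat.andCon_ser_true, EDat.andCon_ser_false]
    rw [← Finset.sum_add_distrib]
    exact hf _ _ (mono_sec (mono_sec m1 false) false) (mono_sec (mono_sec m1 false) true)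
      (fun γ => (n0 _).trans (le _)) (fun γ => sec_le (mono_sec m1 false) γ) J
  · rw [sum_bool_prod]; simp only [serE, EDat.andCon_ser_true, EDat.andCon_ser_false]
    rw [← Finset.sum_add_distrib]
    exact hf _ _ (mono_sec (mono_sec m0 true) false) (mono_sec (mono_sec m0 true) true)
      (fun γ => n0 _) (fun γ => sec_le (mono_sec m0 true) γ) J

end RootForm

end FK

end Summit.CriticalPhenomena.PercolationContinuityZ3.Theorems
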